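import Literature.Topology.FourManifolds.TimeDependentFlow
import Literature.Analysis.Calculus.SeeleyExtension
import Literature.Geometry.Manifold.TimeDependentIntegralCurve
import Mathlib.Analysis.SpecialFunctions.SmoothTransition
import HarnessLib

/-!
# Flows of time-dependent vector fields given on a closed time interval (Lee 2012, Thm. 9.48)
(topic `Geometry/Manifold`)

A time-dependent vector field `V t x ∈ T_x M` on a closed manifold `M`, of class `C^∞` on
`M × [0, ε]` — in the within-a-set sense of Mathlib: the map `(x, t) ↦ (x, V t x)` into `TM` is
`ContMDiffOn` on `M × [0, ε]`, one-sided in `t` at the endpoints — generates maps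
`ψ_t : M → M`, `ψ_0 = id`, with `(x, t) ↦ ψ_t x` of class `C^∞`, every orbit `t ↦ ψ_t x` an
integral curve of `V` on `[0, ε]` (`IsTimeDepMIntegralCurveOn`, `TimeDependentIntegralCurve.lean`),
and every differential `dψ_t|_x` injective: `exists_timeDepFlow_Icc`. This is the
closed-time-interval form of the fundamental theorem on time-dependent flows, Lee 2012,
Thm. 9.48 (on a compact manifold the flow is global, loc. cit. and Thm. 9.16), in the shape of
the hypothesis `hFL` of the DeTurck reduction of short-time existence of the Ricci flow
(`Literature.Geometry.Riemannian.ricciFlow_shortTime_existence_of_deTurck'`,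
`DeTurckFieldRegularity.lean`; Topping 2006, §5.2, Step 2 (ii): "use this to generate a
family of diffeomorphisms `ψ_t` with `ψ_0 = id`").

Everything is proved, by reduction to the library:

* `timeExtend ε V` — **Seeley's extension in the time variable**, fibre by fibre: the library's
  extension operator `Literature.Analysis.Calculus.Seeley.extend` (`SeeleyExtension.lean`;
  Seeley 1964: `E f (t) = ∑ₖ aₖ φ(2ᵏ t / ε) f(-2ᵏ t)` for `t < 0`) applied to `t ↦ V t x ∈ T_x M`
  for each `x`; it is `V` for `t ≥ 0` (`timeExtend_of_nonneg`) and, read in a trivialization of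
  `TM`, it is the Seeley extension of the coordinate expression of `V` (`continuousLinearMapAt_timeExtend`),
  whence `C^∞` on `M × (-∞, ε)` if `V` is `C^∞` on `M × [0, ε)` (`contMDiffOn_timeExtend`,
  from `Seeley.contDiffOn_extend`);
* `exists_contMDiff_extension_Icc` — extending at both ends and cutting off in time: a field
  `C^∞` on `M × [0, ε]` agrees on `[0, ε]` with a field `C^∞` on all of `M × ℝ` and vanishing
  for `t ∉ [-1, ε + 1]`;
* `exists_timeDepFlow_Icc` — **the flow**: the extended field generates an ambient isotopy of
  the closed manifold `M` (`Literature.Topology.FourManifolds.exists_ambientIsotopy_of_timeDependent`,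
  `TimeDependentFlow.lean`: Hirsch 1976, Ch. 8 §1, Thms. 1.1–1.2, via the suspension field
  `(1, G)` on `ℝ × M` and the tree's global-flow theorem), whose stages are the required `ψ_t`.

## References

* J. M. Lee, *Introduction to Smooth Manifolds*, 2nd ed. (2012), Ch. 9, Thm. 9.48 and
  pp. 236–237 (time-dependent flows), Thm. 9.16 (compact support). [Lee2012]
* M. W. Hirsch, *Differential Topology* (1976), Ch. 8 §1, Thms. 1.1–1.2. [HirschDT1976]
* R. T. Seeley, *Extension of `C^∞` functions defined in a half space*, Proc. Amer. Math. Soc.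
  15 (1964), 625–626. [Seeley1964]
* P. Topping, *Lectures on the Ricci flow* (2006), §5.2, Step 2 (ii). [Topping2006]
-/

noncomputable section

open Bundle Set Filter Function
open scoped Manifold ContDiff Topology

namespace Literature.Geometry.Manifold

open Literature.Analysis.Calculus Literature.Topology.FourManifolds

universe u v w

variable {E : Type*} [NormedAddCommGroup E] [NormedSpace ℝ E] {H : Type*} [TopologicalSpace H]
  {I : ModelWithCorners ℝ E H} {M : Type*} [TopologicalSpace M] [ChartedSpace H M]
  [IsManifold I ∞ M]

/-! ### Fibrewise scalar multiples of smooth families of tangent vectors -/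

/-- A family of tangent vectors `p ↦ (b p, V p)`, `C^n` within `s` at `p₀` as a map into `TM`,
multiplied by a real function `C^n` within `s` at `p₀`, is `C^n` within `s` at `p₀` (the
trivializations of `TM` are fibrewise linear). [folklore] -/
theorem ContMDiffWithinAt.smul_tangentVector {P : Type*} [TopologicalSpace P] {HP : Type*}
    [TopologicalSpace HP] {EP : Type*} [NormedAddCommGroup EP] [NormedSpace ℝ EP]
    {IP : ModelWithCorners ℝ EP HP} [ChartedSpace HP P] {n : ℕ∞ω} {b : P → M} {c : P → ℝ}
    {V : ∀ p : P, TangentSpace I (b p)} {s : Set P} {p₀ : P}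
    (hc : ContMDiffWithinAt IP 𝓘(ℝ, ℝ) n c s p₀)
    (hV : ContMDiffWithinAt IP I.tangent n (fun p ↦ (⟨b p, V p⟩ : TangentBundle I M)) s p₀) :
    ContMDiffWithinAt IP I.tangent n (fun p ↦ (⟨b p, c p • V p⟩ : TangentBundle I M)) s p₀ := by
  rw [contMDiffWithinAt_totalSpace] at hV ⊢
  refine ⟨hV.1, ?_⟩
  set e := trivializationAt E (TangentSpace I : M → Type _) (b p₀) with he
  have hev : ∀ᶠ p in 𝓝[s] p₀, b p ∈ e.baseSet :=
    hV.1.continuousWithinAt.preimage_mem_nhdsWithin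
      (e.open_baseSet.mem_nhds (FiberBundle.mem_baseSet_trivializationAt' (b p₀)))
  refine (hc.smul hV.2).congr_of_eventuallyEq ?_ ?_
  · filter_upwards [hev] with p hp
    exact (e.linear ℝ hp).map_smul _ _
  · exact (e.linear ℝ (FiberBundle.mem_baseSet_trivializationAt' (b p₀))).map_smul _ _

/-! ### Seeley's extension in the time variable -/

section Seeley

/-- **Seeley's extension in time of a time-dependent family of tangent vectors**, fibre by
fibre: for each `x`, the library's extension operator `Seeley.extend ε` (Seeley 1964;
`SeeleyExtension.lean`) applied to the `T_x M`-valued function `t ↦ V t x` across `t = 0`, using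
its values on `[0, ε)`: `timeExtend ε V t x = V t x` for `t ≥ 0` and
`= ∑ₖ aₖ φ(2ᵏ t / ε) V (-2ᵏ t) x` for `t < 0`. [cite: Seeley1964, Theorem] -/
def timeExtend (ε : ℝ) (V : ℝ → Π x : M, TangentSpace I x) (t : ℝ) (x : M) : TangentSpace I x :=
  Seeley.extend (E' := Unit) (F := E) ε (fun p : ℝ × Unit ↦ (V p.1 x : E)) (t, ())

omit [IsManifold I ∞ M] in
/-- For `t ≥ 0` the extension is the family itself. [cite: Seeley1964, Theorem] -/
theorem timeExtend_of_nonneg {ε : ℝ} (V : ℝ → Π x : M, TangentSpace I x) {t : ℝ} (ht : 0 ≤ t)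
    (x : M) : timeExtend ε V t x = V t x :=
  Seeley.extend_of_nonneg (E' := Unit) (F := E) (δ := ε) (f := fun p : ℝ × Unit ↦ (V p.1 x : E))
    (p := (t, ())) ht

omit [IsManifold I ∞ M] in
/-- Below `t = 0` the extension is, locally, a finite linear combination of values of the family
at positive times (`Seeley.extend_eq_sum_of_lt`). [cite: Seeley1964, Theorem] -/
theorem timeExtend_eq_sum {ε : ℝ} (hε : 0 < ε) (V : ℝ → Π x : M, TangentSpace I x) {t₀ t : ℝ}
    (ht₀ : t₀ < 0) {K : ℕ} (hK : ε / (-t₀) ≤ 2 ^ K) (ht : t < t₀ / 2) (x : M) :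
    timeExtend ε V t x =
      ∑ k ∈ Finset.range K, Seeley.weight ε k t • V (-(2 : ℝ) ^ k * t) x := by
  have h := Seeley.extend_eq_sum_of_lt (E' := Unit) (F := E)
    (f := fun p : ℝ × Unit ↦ (V p.1 x : E)) hε ht₀ hK (p := (t, ())) ht
  rw [timeExtend, h]
  simp only [Seeley.term, Seeley.scale_apply]
  rfl

variable [I.Boundaryless] [CompleteSpace E]

omit [I.Boundaryless] [CompleteSpace E] in
/-- **The time extension read in a trivialization is the Seeley extension of the coordinate
expression.** For `x` in the chart domain of `x₁` and any `t`,
`e_x (timeExtend ε V t x) = Seeley.extend ε F (t, φ x)` with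
`F (s, z) = e (V s (φ⁻¹ z))` (`e` the trivialization of `TM` at `x₁`, `φ = extChartAt I x₁`),
because `e_x` is linear and Seeley's series is locally finite. [folklore] -/
theorem continuousLinearMapAt_timeExtend {ε : ℝ} (hε : 0 < ε)
    (V : ℝ → Π x : M, TangentSpace I x) (x₁ : M) {x : M} (hx : x ∈ (chartAt H x₁).source)
    (t : ℝ) :
    (trivializationAt E (TangentSpace I : M → Type _) x₁).continuousLinearMapAt ℝ x
        (timeExtend ε V t x) =
      Seeley.extend ε (fun r : ℝ × E ↦ (trivializationAt E (TangentSpace I : M → Type _) x₁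
        ⟨(extChartAt I x₁).symm r.2, V r.1 ((extChartAt I x₁).symm r.2)⟩).2)
        (t, extChartAt I x₁ x) := by
  set e := trivializationAt E (TangentSpace I : M → Type _) x₁ with he
  have hxs : x ∈ (extChartAt I x₁).source := by rwa [extChartAt_source]
  have hxe : x ∈ e.baseSet := by rwa [he, TangentBundle.trivializationAt_baseSet]
  -- the coordinate expression as a function of the point
  set Fm : ℝ → M → E := fun s y ↦ (e ⟨y, V s y⟩).2 with hFm
  have hF : ∀ r : ℝ × E, (e ⟨(extChartAt I x₁).symm r.2, V r.1 ((extChartAt I x₁).symm r.2)⟩).2 =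
      Fm r.1 ((extChartAt I x₁).symm r.2) := fun r ↦ rfl
  have hFm_eq : ∀ s, Fm s x = e.continuousLinearMapAt ℝ x (V s x) := fun s ↦
    (e.continuousLinearMapAt_apply_of_mem (R := ℝ) hxe _).symm
  rcases le_or_gt 0 t with ht | ht
  · rw [timeExtend_of_nonneg V ht, Seeley.extend_of_nonneg (p := (t, extChartAt I x₁ x)) ht, hF]
    change _ = Fm t ((extChartAt I x₁).symm (extChartAt I x₁ x))
    rw [(extChartAt I x₁).left_inv hxs, hFm_eq]
  · obtain ⟨K, hK⟩ : ∃ K : ℕ, ε / (-t) ≤ 2 ^ K :=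
      (pow_unbounded_of_one_lt (ε / (-t)) (by norm_num : (1 : ℝ) < 2)).imp fun _ h ↦ h.le
    have htt : t < t / 2 := by linarith
    rw [timeExtend_eq_sum hε V ht hK htt x, Seeley.extend_eq_sum_of_lt hε ht hK
      (p := (t, extChartAt I x₁ x)) htt, map_sum]
    refine Finset.sum_congr rfl fun k _ ↦ ?_
    rw [map_smul, Seeley.term, hF]
    simp only [Seeley.scale_apply]
    rw [(extChartAt I x₁).left_inv hxs, hFm_eq]

set_option maxSynthPendingDepth 2 in
/-- **Seeley's time extension of a family `C^∞` on `M × [0, ε)` is `C^∞` on `M × (-∞, ε)`**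
(as maps into `TM`): in the trivialization at `x₁` the coordinate expression of `timeExtend ε V`
is the Seeley extension of that of `V` (`continuousLinearMapAt_timeExtend`), which is `C^∞` on
`(-∞, ε) × (chart target)` by `Seeley.contDiffOn_extend` (Seeley 1964). [cite: Seeley1964, Theorem] -/
theorem contMDiffOn_timeExtend {ε : ℝ} (hε : 0 < ε) {V : ℝ → Π x : M, TangentSpace I x}
    (hV : ContMDiffOn (I.prod 𝓘(ℝ, ℝ)) I.tangent ∞
      (fun q : M × ℝ ↦ (⟨q.1, V q.2 q.1⟩ : TangentBundle I M)) (univ ×ˢ Ico 0 ε)) :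
    ContMDiffOn (I.prod 𝓘(ℝ, ℝ)) I.tangent ∞
      (fun q : M × ℝ ↦ (⟨q.1, timeExtend ε V q.2 q.1⟩ : TangentBundle I M)) (univ ×ˢ Iio ε) := by
  rintro ⟨x₁, t₁⟩ ⟨-, ht₁⟩
  set e := trivializationAt E (TangentSpace I : M → Type _) x₁ with he
  set φ := extChartAt I x₁ with hφ
  have hUe : ∀ y ∈ (chartAt H x₁).source, y ∈ e.baseSet := fun y hy ↦ by
    rwa [he, TangentBundle.trivializationAt_baseSet]
  -- the coordinate expression of `V` on `(chart domain) × [0, ε)`, on the manifold `M × ℝ`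
  have hmaps : MapsTo (fun q : M × ℝ ↦ (⟨q.1, V q.2 q.1⟩ : TangentBundle I M))
      ((chartAt H x₁).source ×ˢ Ico 0 ε) e.source := fun q hq ↦ by
    rw [e.mem_source]; exact hUe q.1 hq.1
  have h1 : ContMDiffOn (I.prod 𝓘(ℝ, ℝ)) 𝓘(ℝ, E) ∞ (fun q : M × ℝ ↦ (e ⟨q.1, V q.2 q.1⟩).2)
      ((chartAt H x₁).source ×ˢ Ico 0 ε) :=
    ((e.contMDiffOn_iff hmaps).1 (hV.mono (prod_mono (subset_univ _) Subset.rfl))).2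
  -- read in the chart `φ × id` of `M × ℝ` at `(x₁, 0)`
  have key := (contMDiffOn_iff.1 h1).2 (x₁, 0) ((e ⟨x₁, V 0 x₁⟩).2)
  have hset : (extChartAt (I.prod 𝓘(ℝ, ℝ)) (x₁, (0 : ℝ))).target ∩
      (extChartAt (I.prod 𝓘(ℝ, ℝ)) (x₁, (0 : ℝ))).symm ⁻¹'
        ((chartAt H x₁).source ×ˢ Ico 0 ε ∩ (fun q : M × ℝ ↦ (e ⟨q.1, V q.2 q.1⟩).2) ⁻¹'
          (extChartAt 𝓘(ℝ, E) ((e ⟨x₁, V 0 x₁⟩).2)).source) =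
      (φ.target ∩ φ.symm ⁻¹' (chartAt H x₁).source) ×ˢ Ico 0 ε := by
    ext ⟨z, s⟩
    simp only [extChartAt_prod, PartialEquiv.prod_target, PartialEquiv.prod_symm,
      PartialEquiv.prod_coe, extChartAt_model_space_eq_id, PartialEquiv.refl_target,
      PartialEquiv.refl_symm, PartialEquiv.refl_coe, PartialEquiv.refl_source, preimage_univ,
      inter_univ, mem_inter_iff, mem_prod, mem_univ, and_true, mem_preimage, hφ, id]
    tauto
  have hVt : φ.target ∩ φ.symm ⁻¹' (chartAt H x₁).source = φ.target := by
    refine inter_eq_left.2 fun z hz ↦ ?_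
    rw [mem_preimage, ← extChartAt_source I]
    exact φ.map_target hz
  rw [hset, hVt] at key
  -- the coordinate expression `F (s, z)` in Seeley's variable order, smooth on the slab
  set F : ℝ × E → E := fun r ↦ (e ⟨φ.symm r.2, V r.1 (φ.symm r.2)⟩).2 with hF_def
  have hF : ContDiffOn ℝ ∞ F (Seeley.slab ε φ.target) := by
    have hswap : ContDiff ℝ ∞ (fun r : ℝ × E ↦ ((r.2, r.1) : E × ℝ)) :=
      contDiff_snd.prodMk contDiff_fst
    refine (key.comp hswap.contDiffOn fun r hr ↦ mk_mem_prod hr.2 hr.1).congr fun r _ ↦ ?_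
    change F r = extChartAt 𝓘(ℝ, E) ((e ⟨x₁, V 0 x₁⟩).2)
      ((fun q : M × ℝ ↦ (e ⟨q.1, V q.2 q.1⟩).2)
        ((extChartAt (I.prod 𝓘(ℝ, ℝ)) (x₁, (0 : ℝ))).symm (r.2, r.1)))
    rw [extChartAt_prod_real_symm_apply]
    simp only [extChartAt_model_space_eq_id, PartialEquiv.refl_coe, id_eq]
    rfl
  have hext : ContDiffOn ℝ ∞ (Seeley.extend ε F) (Iio ε ×ˢ φ.target) :=
    Seeley.contDiffOn_extend hε (isOpen_extChartAt_target x₁) hF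
  -- the composite `q ↦ Seeley.extend ε F (q.2, φ q.1)` is `C^∞` at `(x₁, t₁)`
  have hin : ContMDiffAt (I.prod 𝓘(ℝ, ℝ)) 𝓘(ℝ, ℝ × E) ∞ (fun q : M × ℝ ↦ ((q.2, φ q.1) : ℝ × E))
      (x₁, t₁) :=
    contMDiffAt_snd.prodMk_space
      ((contMDiffAt_extChartAt (x := x₁)).comp (x₁, t₁) contMDiffAt_fst)
  have hG : ContMDiffAt (I.prod 𝓘(ℝ, ℝ)) 𝓘(ℝ, E) ∞
      (fun q : M × ℝ ↦ Seeley.extend ε F (q.2, φ q.1)) (x₁, t₁) :=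
    ContDiffAt.comp_contMDiffAt (f := fun q : M × ℝ ↦ ((q.2, φ q.1) : ℝ × E)) (x := (x₁, t₁))
      (hext.contDiffAt ((isOpen_Iio.prod (isOpen_extChartAt_target x₁)).mem_nhds
        (mk_mem_prod ht₁ (mem_extChartAt_target x₁)))) hin
  -- conclusion, through `contMDiffAt_totalSpace`
  apply ContMDiffAt.contMDiffWithinAt
  rw [contMDiffAt_totalSpace]
  refine ⟨contMDiffAt_fst, ?_⟩
  refine hG.congr_of_eventuallyEq ?_
  have hev : ∀ᶠ q : M × ℝ in 𝓝 (x₁, t₁), q.1 ∈ (chartAt H x₁).source :=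
    continuousAt_fst.preimage_mem_nhds ((chartAt H x₁).open_source.mem_nhds
      (mem_chart_source H x₁))
  filter_upwards [hev] with q hq
  change (e ⟨q.1, timeExtend ε V q.2 q.1⟩).2 = Seeley.extend ε F (q.2, φ q.1)
  rw [← e.continuousLinearMapAt_apply_of_mem (R := ℝ) (hUe q.1 hq) _]
  exact continuousLinearMapAt_timeExtend hε V x₁ hq q.2

/-- **Smooth extension in time from `[0, ε]` to `ℝ`, with compact time-support.** A family of
tangent vectors `V t x ∈ T_x M`, `C^∞` on `M × [0, ε]` as a map into `TM` (one-sided in `t` at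
the endpoints), agrees on `[0, ε]` with a family `W` which is `C^∞` on all of `M × ℝ` and
vanishes for `t ∉ [-1, ε + 1]`: Seeley extension across `t = 0` (`timeExtend`), then across
`t = ε` (the same applied to the time-reversed family), then multiplication by a smooth cutoff
in time (Mathlib's `Real.smoothTransition`). [cite: Seeley1964, Theorem] -/
theorem exists_contMDiff_extension_Icc {ε : ℝ} (hε : 0 < ε) {V : ℝ → Π x : M, TangentSpace I x}
    (hV : ContMDiffOn (I.prod 𝓘(ℝ, ℝ)) I.tangent ∞
      (fun q : M × ℝ ↦ (⟨q.1, V q.2 q.1⟩ : TangentBundle I M)) (univ ×ˢ Icc 0 ε)) :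
    ∃ W : ℝ → Π x : M, TangentSpace I x, (∀ t ∈ Icc 0 ε, W t = V t) ∧
      (∀ t ∉ Icc (-1) (ε + 1), ∀ x, W t x = 0) ∧
      ContMDiff (I.prod 𝓘(ℝ, ℝ)) I.tangent ∞
        (fun q : M × ℝ ↦ (⟨q.1, W q.2 q.1⟩ : TangentBundle I M)) := by
  /- first extension, across `t = 0` -/
  set V₁ : ℝ → Π x : M, TangentSpace I x := timeExtend ε V with hV₁_def
  have hV₁V : ∀ t, 0 ≤ t → V₁ t = V t := fun t ht ↦ funext fun x ↦ timeExtend_of_nonneg V ht x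
  have hV₁s : ContMDiffOn (I.prod 𝓘(ℝ, ℝ)) I.tangent ∞
      (fun q : M × ℝ ↦ (⟨q.1, V₁ q.2 q.1⟩ : TangentBundle I M)) (univ ×ˢ Iio ε) :=
    contMDiffOn_timeExtend hε (hV.mono (prod_mono Subset.rfl Ico_subset_Icc_self))
  -- `V₁` is also `C^∞` on `M × (0, ε]` (within), being `V` there
  have hV₁s' : ContMDiffOn (I.prod 𝓘(ℝ, ℝ)) I.tangent ∞
      (fun q : M × ℝ ↦ (⟨q.1, V₁ q.2 q.1⟩ : TangentBundle I M)) (univ ×ˢ Ioc 0 ε) :=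
    (hV.mono (prod_mono Subset.rfl Ioc_subset_Icc_self)).congr fun q hq ↦ by
      simp only [hV₁V q.2 hq.2.1.le]
  /- second extension, across `t = ε`: the time-reversed family `s ↦ V₁ (ε - s)` -/
  set Vr : ℝ → Π x : M, TangentSpace I x := fun s ↦ V₁ (ε - s) with hVr_def
  have hflip : ContMDiff (I.prod 𝓘(ℝ, ℝ)) (I.prod 𝓘(ℝ, ℝ)) ∞ (fun q : M × ℝ ↦ (q.1, ε - q.2)) :=
    contMDiff_fst.prodMk (((contDiff_const (c := ε)).sub contDiff_id).comp_contMDiff contMDiff_snd)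
  have hVrs : ContMDiffOn (I.prod 𝓘(ℝ, ℝ)) I.tangent ∞
      (fun q : M × ℝ ↦ (⟨q.1, Vr q.2 q.1⟩ : TangentBundle I M)) (univ ×ˢ Ico 0 ε) := by
    have hmaps : MapsTo (fun q : M × ℝ ↦ (q.1, ε - q.2)) (univ ×ˢ Ico 0 ε) (univ ×ˢ Ioc 0 ε) := by
      rintro ⟨x, s⟩ ⟨-, hs⟩
      have hs0 : 0 ≤ s := hs.1
      have hsε : s < ε := hs.2
      exact mk_mem_prod (mem_univ _) ⟨by linarith, by linarith⟩
    have h := hV₁s'.comp hflip.contMDiffOn hmaps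
    exact h
  set V₂ : ℝ → Π x : M, TangentSpace I x := fun t ↦ timeExtend ε Vr (ε - t) with hV₂_def
  have hV₂V₁ : ∀ t, t ≤ ε → V₂ t = V₁ t := by
    intro t ht
    funext x
    simp only [hV₂_def]
    rw [timeExtend_of_nonneg Vr (by linarith)]
    show V₁ (ε - (ε - t)) x = V₁ t x
    rw [show ε - (ε - t) = t by ring]
  have hV₂V : ∀ t ∈ Icc 0 ε, V₂ t = V t := fun t ht ↦ by rw [hV₂V₁ t ht.2, hV₁V t ht.1]
  have hV₂s : ContMDiff (I.prod 𝓘(ℝ, ℝ)) I.tangent ∞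
      (fun q : M × ℝ ↦ (⟨q.1, V₂ q.2 q.1⟩ : TangentBundle I M)) := by
    have h2 : ContMDiffOn (I.prod 𝓘(ℝ, ℝ)) I.tangent ∞
        (fun q : M × ℝ ↦ (⟨q.1, V₂ q.2 q.1⟩ : TangentBundle I M)) (univ ×ˢ Ioi 0) := by
      have hmaps : MapsTo (fun q : M × ℝ ↦ (q.1, ε - q.2)) (univ ×ˢ Ioi 0) (univ ×ˢ Iio ε) := by
        rintro ⟨x, t⟩ ⟨-, ht⟩
        have ht0 : 0 < t := ht
        exact mk_mem_prod (mem_univ _) (show ε - t < ε by linarith)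
      have h := (contMDiffOn_timeExtend hε hVrs).comp hflip.contMDiffOn hmaps
      exact h
    have h1 : ContMDiffOn (I.prod 𝓘(ℝ, ℝ)) I.tangent ∞
        (fun q : M × ℝ ↦ (⟨q.1, V₂ q.2 q.1⟩ : TangentBundle I M)) (univ ×ˢ Iio ε) :=
      hV₁s.congr fun q hq ↦ by simp only [hV₂V₁ q.2 (le_of_lt hq.2)]
    rintro ⟨x, t⟩
    rcases lt_or_ge t ε with ht | ht
    · exact (h1 (x, t) (mk_mem_prod (mem_univ _) ht)).contMDiffAt
        ((isOpen_univ.prod isOpen_Iio).mem_nhds (mk_mem_prod (mem_univ _) ht))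
    · have ht' : t ∈ Ioi (0 : ℝ) := lt_of_lt_of_le hε ht
      exact (h2 (x, t) (mk_mem_prod (mem_univ _) ht')).contMDiffAt
        ((isOpen_univ.prod isOpen_Ioi).mem_nhds (mk_mem_prod (mem_univ _) ht'))
  /- cutoff in time -/
  set χ : ℝ → ℝ := fun t ↦ Real.smoothTransition (t + 1) * Real.smoothTransition (ε + 1 - t)
    with hχ_def
  have hχs : ContDiff ℝ ∞ χ :=
    (Real.smoothTransition.contDiff.comp (contDiff_id.add contDiff_const)).mul
      (Real.smoothTransition.contDiff.comp (contDiff_const.sub contDiff_id))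
  have hχ1 : ∀ t ∈ Icc 0 ε, χ t = 1 := fun t ht ↦ by
    simp only [hχ_def, Real.smoothTransition.one_of_one_le (show 1 ≤ t + 1 by linarith [ht.1]),
      Real.smoothTransition.one_of_one_le (show 1 ≤ ε + 1 - t by linarith [ht.2]), mul_one]
  have hχ0 : ∀ t ∉ Icc (-1) (ε + 1), χ t = 0 := by
    intro t ht
    simp only [mem_Icc, not_and_or, not_le] at ht
    rcases ht with h | h
    · simp only [hχ_def, Real.smoothTransition.zero_of_nonpos (show t + 1 ≤ 0 by linarith),
        zero_mul]
    · simp only [hχ_def, Real.smoothTransition.zero_of_nonpos (show ε + 1 - t ≤ 0 by linarith),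
        mul_zero]
  refine ⟨fun t x ↦ χ t • V₂ t x, fun t ht ↦ ?_, fun t ht x ↦ ?_, ?_⟩
  · funext x
    show χ t • V₂ t x = V t x
    rw [hχ1 t ht, one_smul, hV₂V t ht]
  · show χ t • V₂ t x = 0
    rw [hχ0 t ht, zero_smul]
  · intro q
    exact (ContMDiffWithinAt.smul_tangentVector
      ((hχs.comp_contMDiff contMDiff_snd) q).contMDiffWithinAt
      (hV₂s q).contMDiffWithinAt).contMDiffAt univ_mem

end Seeley

/-! ### The flow on `[0, ε]` -/

section Flow

-- the tangent spaces of `ℝ × M` are the model space `ℝ × E` by definition, which the derivative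
-- lemmas must see through (as in `TimeDependentFlow.lean`)
set_option backward.isDefEq.respectTransparency false in
/-- **Flows of time-dependent vector fields on closed manifolds, over a closed time interval**
(Lee 2012, Thm. 9.48 with Thm. 9.16: a smooth time-dependent vector field on a compact manifold
generates a global smooth time-dependent flow; here the field is given only on `M × [0, ε]`,
`C^∞` there in the within-a-set sense, and the flow is produced on `[0, ε]`). For a closed
manifold `M` (compact, Hausdorff, boundaryless, finite-dimensional complete model), `ε > 0`,
and `V t x ∈ T_x M` with `(x, t) ↦ (x, V t x)` of class `C^∞` on `M × [0, ε]`, there are maps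
`ψ t : M → M` with `ψ 0 = id`, `(x, t) ↦ ψ t x` of class `C^∞` (on `M × [0, ε]`), every orbit
`t ↦ ψ t x` an integral curve of `V` on `[0, ε]` (`IsTimeDepMIntegralCurveOn`, one-sided at the
endpoints), and every differential `dψ_t|_x` injective. Proof: extend `V` to a `C^∞` field on
`M × ℝ` with compact time-support (`exists_contMDiff_extension_Icc`, Seeley) and take the
stages of the ambient isotopy it generates
(`Literature.Topology.FourManifolds.exists_ambientIsotopy_of_timeDependent`, Hirsch 1976,
Ch. 8 §1, Thms. 1.1–1.2): they are diffeomorphisms, jointly smooth, start at `id`, and their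
tracks `s ↦ (s, ψ s x)` are integral curves of the suspension `(1, W)`, whose second
components are integral curves of `W = V` on `[0, ε]`. This is the hypothesis `hFL` of
`Literature.Geometry.Riemannian.ricciFlow_shortTime_existence_of_deTurck'`.
[cite: Lee2012, Ch. 9, Thm. 9.48] [cite: HirschDT1976, Ch. 8 §1, Thms. 1.1–1.2] -/
theorem exists_timeDepFlow_Icc {E : Type u} [NormedAddCommGroup E] [NormedSpace ℝ E]
    [FiniteDimensional ℝ E] [CompleteSpace E] {H : Type v} [TopologicalSpace H]
    (I : ModelWithCorners ℝ E H) [I.Boundaryless] (M : Type w) [TopologicalSpace M] [T2Space M]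
    [CompactSpace M] [ChartedSpace H M] [IsManifold I ∞ M] {ε : ℝ} (hε : 0 < ε)
    {V : ℝ → Π x : M, TangentSpace I x}
    (hV : ContMDiffOn (I.prod 𝓘(ℝ, ℝ)) I.tangent ∞
      (fun q : M × ℝ ↦ (⟨q.1, V q.2 q.1⟩ : TangentBundle I M)) (univ ×ˢ Icc 0 ε)) :
    ∃ ψ : ℝ → M → M, ψ 0 = id ∧
      ContMDiffOn (I.prod 𝓘(ℝ, ℝ)) I ∞ (fun q : M × ℝ ↦ ψ q.2 q.1) (univ ×ˢ Icc 0 ε) ∧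
      (∀ x : M, IsTimeDepMIntegralCurveOn (fun t ↦ ψ t x) V (Icc 0 ε)) ∧
      (∀ t ∈ Icc 0 ε, ∀ x : M, Injective (mfderiv I I (ψ t) x)) := by
  obtain ⟨W, hWV, hW0, hWs⟩ := exists_contMDiff_extension_Icc hε hV
  -- the extended field in the variable order `ℝ × M` of `TimeDependentFlow.lean`
  have hG : ContMDiff (𝓘(ℝ, ℝ).prod I) I.tangent ∞
      (fun p : ℝ × M ↦ (⟨p.2, W p.1 p.2⟩ : TangentBundle I M)) :=
    hWs.comp (contMDiff_snd.prodMk contMDiff_fst)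
  obtain ⟨Ψ, hΨ⟩ := exists_ambientIsotopy_of_timeDependent (J := I) (N := M) (a := -1)
    (b := ε + 1) (G := fun p : ℝ × M ↦ W p.1 p.2) hG (fun p hp ↦ hW0 p.1 hp p.2)
  refine ⟨Ψ.toFun, Ψ.map_zero, ?_, fun x t ht ↦ ?_, fun t _ x ↦ ?_⟩
  · exact (Ψ.contMDiff.comp (contMDiff_snd.prodMk contMDiff_fst)).contMDiffOn
  · -- the track `s ↦ (s, Ψ_s x)` is an integral curve of `(1, W)`; project to `M`
    have htrack := hΨ x t
    have h2 := (hasMFDerivAt_snd (I := 𝓘(ℝ, ℝ)) (I' := I)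
      (((t, Ψ.toFun t x) : ℝ × M))).comp t htrack
    have h3 : HasMFDerivAt 𝓘(ℝ, ℝ) I (fun s ↦ Ψ.toFun s x) t
        ((1 : ℝ →L[ℝ] ℝ).smulRight (W t (Ψ.toFun t x))) := by
      refine h2.congr_mfderiv ?_
      rw [ContinuousLinearMap.ext_iff]
      intro r
      rw [ContinuousLinearMap.comp_apply, ContinuousLinearMap.smulRight_apply,
        ContinuousLinearMap.smulRight_apply, map_smul]
      rfl
    rw [hWV t ht] at h3
    exact h3.hasMFDerivWithinAt
  · intro a b hab
    have hn : (∞ : ℕ∞ω) ≠ 0 := by simp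
    apply (((Ψ.isLocalDiffeomorph t) x).mfderivToContinuousLinearEquiv hn).injective
    change mfderiv I I (Ψ.toFun t) x a = mfderiv I I (Ψ.toFun t) x b
    exact hab

end Flow

end Literature.Geometry.Manifold
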